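import Mathlib.NumberTheory.Height.NumberField
import Mathlib.Analysis.SpecialFunctions.Log.Basic
import Mathlib.Tactic
import HarnessLib

/-!
# Cell abc-stewartyu, Gen-3 frames (cruxes `Y07Odd`/`Y07Two`): a COMMON DENOMINATOR for all monomials
# `∏ⱼ αⱼ^{eⱼ}` with signed exponents in a box, with its archimedean and height bounds

`Summits/ABC/StewartYu/MonomialDenominators.lean` — cell `abc-stewartyu` (HOME `run/shared/lean/pub/abc-stewartyu/`),
route `PadicPrimesKummerThird`, seat p3 (g5), F-two LEAD (layer F1 "values" of HOME/p3/memo-09 §3).  One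
definition and theorems, place-free arithmetic of `ℚ`.

The values of the Gen-3 auxiliary functions at an integer point `x` are `ℤ`-combinations of the rational
monomials `∏ⱼ αⱼ^{uⱼ x}` over the Matveev box `|uⱼ| ≤ Dⱼ` (signed exponents).  Liouville's inequality
(`SetupQ.padicNorm_ge_of_int_mul`: `‖r‖_p ≥ 1/(D·M)` if `D·r ∈ ℤ`, `|r| ≤ M`) and Siegel's lemma
(`SiegelOnFinset.exists_int_vec_of_finset`) both need ONE clearing denominator for ALL these monomials
together with a bound for the cleared numerators.  With `αⱼ = aⱼ/cⱼ` in lowest terms: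

  `monDen α E = ∏ⱼ (|aⱼ|·cⱼ)^{Eⱼ}`,  and for every `e` with `|eⱼ| ≤ Eⱼ`:
  `monDen α E · ∏ⱼ αⱼ^{eⱼ} ∈ ℤ`,  `|monDen α E · ∏ⱼ αⱼ^{eⱼ}| ≤ (monDen α E)²`,
  `log monDen α E ≤ 2·∑ⱼ Eⱼ·h(αⱼ)`

(`exists_int_monDen_mul_prod_zpow`, `log_monDen_le`) — so with Matveev's height-weighted box
`Eⱼ ≈ L/h(αⱼ)` the cost is `≈ 2nL`, uniformly in which generators occur: the mechanism behind `cⁿ`.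
One factor: `(|a|c)^E · q^e = (|a|c)^{E−|e|}·wᵏ` with the INTEGER `w = |a|·a` (`e ≥ 0`) or `w = ±c²`
(`e < 0`), `|w| ≤ (|a|c)²` (`int_mul_zpow_single`).

WHAT THIS IS NOT: no `p`-adic content; no crux moves.

References: Yu. V. Nesterenko, LNM 1819 (2003), §3.2 (heights of the values); E. M. Matveev, Izv. Math. 64
(2000) §3 (the weighted box).
-/

noncomputable section

open Finset

namespace Summit.ABC.StewartYu.MonomialDen

variable {m : ℕ}

/-- The size `|a|·c ≥ 1` of a nonzero rational `a/c` in lowest terms. [folklore] -/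
def qsize (q : ℚ) : ℕ := q.num.natAbs * q.den

/-- `1 ≤ qsize q` for `q ≠ 0`. [folklore] -/
theorem one_le_qsize {q : ℚ} (hq : q ≠ 0) : 1 ≤ qsize q := by
  unfold qsize
  have h1 : 1 ≤ q.num.natAbs := Int.natAbs_pos.mpr (Rat.num_ne_zero.mpr hq)
  have h2 : 1 ≤ q.den := q.den_pos
  exact one_le_mul h1 h2 |>.trans_eq' rfl |> fun h => by nlinarith

/-- `log (qsize q) ≤ 2·h(q)` (`h(q) = log max(|a|, c)`). [folklore] -/
theorem log_qsize_le {q : ℚ} (hq : q ≠ 0) : Real.log (qsize q : ℝ) ≤ 2 * Height.logHeight₁ q := by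
  rw [Rat.logHeight₁_eq_log_max, Nat.cast_max]
  have ha : (1 : ℝ) ≤ q.num.natAbs := by exact_mod_cast Int.natAbs_pos.mpr (Rat.num_ne_zero.mpr hq)
  have hc : (1 : ℝ) ≤ q.den := by exact_mod_cast q.den_pos
  have hM : (q.num.natAbs : ℝ) ≤ max (q.num.natAbs : ℝ) (q.den : ℝ) := le_max_left _ _
  have hM' : (q.den : ℝ) ≤ max (q.num.natAbs : ℝ) (q.den : ℝ) := le_max_right _ _
  unfold qsize
  push_cast
  rw [Real.log_mul (by linarith) (by linarith)]
  have h1 := Real.log_le_log (by linarith) hM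
  have h2 := Real.log_le_log (by linarith) hM'
  linarith

/-- `qsize q · q = |a|·a` (an integer). [folklore] -/
theorem qsize_mul_self (q : ℚ) : ((qsize q : ℕ) : ℚ) * q = ((|q.num| * q.num : ℤ) : ℚ) := by
  unfold qsize
  push_cast
  rw [Nat.cast_natAbs]
  push_cast
  have h := Rat.mul_den_eq_num q
  calc (|(q.num : ℚ)|) * (q.den : ℚ) * q = |(q.num : ℚ)| * (q * q.den) := by ring
    _ = |(q.num : ℚ)| * q.num := by rw [h]

/-- `qsize q · q⁻¹ = sign(a)·c²` (an integer), `q ≠ 0`. [folklore] -/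
theorem qsize_mul_inv {q : ℚ} (hq : q ≠ 0) :
    ((qsize q : ℕ) : ℚ) * q⁻¹ = ((q.num.sign * (q.den : ℤ) ^ 2 : ℤ) : ℚ) := by
  have hnum : (q.num : ℚ) ≠ 0 := by exact_mod_cast Rat.num_ne_zero.mpr hq
  have hden : q⁻¹ * (q.num : ℚ) = q.den := by
    rw [← Rat.mul_den_eq_num q]; field_simp
  unfold qsize
  push_cast
  rw [Nat.cast_natAbs]
  push_cast
  rcases lt_or_gt_of_ne (Rat.num_ne_zero.mpr hq) with hneg | hpos
  · rw [Int.sign_eq_neg_one_of_neg hneg, abs_of_neg (by exact_mod_cast hneg)]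
    push_cast
    linear_combination (-(q.den : ℚ)) * hden
  · rw [Int.sign_eq_one_of_pos hpos, abs_of_pos (by exact_mod_cast hpos)]
    push_cast
    linear_combination ((q.den : ℚ)) * hden

/-- **One factor**: for `q = a/c ≠ 0` in lowest terms and `|e| ≤ E`,
`(|a|c)^E · q^e = z ∈ ℤ` with `|z| ≤ ((|a|c)^E)²`. [folklore] -/
theorem int_mul_zpow_single {q : ℚ} (hq : q ≠ 0) {E : ℕ} {e : ℤ} (he : |e| ≤ (E : ℤ)) :
    ∃ z : ℤ, ((qsize q ^ E : ℕ) : ℚ) * q ^ e = z ∧ |z| ≤ ((qsize q : ℤ) ^ E) ^ 2 := by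
  have ha0 : q.num ≠ 0 := Rat.num_ne_zero.mpr hq
  have hsz1 : (1 : ℤ) ≤ qsize q := by exact_mod_cast one_le_qsize hq
  have hsz : (qsize q : ℤ) = |q.num| * q.den := by
    unfold qsize; push_cast; rfl
  have hc1 : (1 : ℤ) ≤ q.den := by exact_mod_cast q.den_pos
  have ha1 : (1 : ℤ) ≤ |q.num| := Int.one_le_abs ha0
  -- the integer `w` with `qsize q · q^{sign e} = w`, `|w| ≤ (qsize q)²`
  set k : ℕ := e.natAbs with hk
  have hkE : k ≤ E := by
    have : (k : ℤ) ≤ E := by rw [hk, Int.natCast_natAbs]; exact he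
    exact_mod_cast this
  obtain ⟨w, hw, hwabs⟩ : ∃ w : ℤ, ((qsize q : ℕ) : ℚ) * q ^ (e.sign) = w ∧ |w| ≤ (qsize q : ℤ) ^ 2 := by
    rcases lt_trichotomy e 0 with hneg | hzero | hpos
    · refine ⟨q.num.sign * (q.den : ℤ) ^ 2, ?_, ?_⟩
      · rw [Int.sign_eq_neg_one_of_neg hneg, zpow_neg, zpow_one]; exact qsize_mul_inv hq
      · rw [abs_mul, abs_pow, hsz]
        have h1 : |q.num.sign| = 1 := by
          rcases lt_or_gt_of_ne ha0 with h | h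
          · rw [Int.sign_eq_neg_one_of_neg h]; rfl
          · rw [Int.sign_eq_one_of_pos h]; rfl
        rw [h1, one_mul, Nat.abs_cast, mul_pow]
        have hA : (1 : ℤ) ≤ |q.num| ^ 2 := one_le_pow₀ ha1
        have hC : (0 : ℤ) ≤ (q.den : ℤ) ^ 2 := by positivity
        nlinarith
    · refine ⟨qsize q, ?_, ?_⟩
      · rw [hzero, Int.sign_zero, zpow_zero, mul_one]; norm_cast
      · rw [Nat.abs_cast]; nlinarith
    · refine ⟨|q.num| * q.num, ?_, ?_⟩
      · rw [Int.sign_eq_one_of_pos hpos, zpow_one]; exact qsize_mul_self q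
      · rw [abs_mul, abs_abs, hsz, mul_pow, ← pow_two]
        have hA : (0 : ℤ) ≤ |q.num| ^ 2 := by positivity
        have hC : (1 : ℤ) ≤ (q.den : ℤ) ^ 2 := one_le_pow₀ hc1
        nlinarith
  -- `q^e = (q^{sign e})^k`
  have hqe : q ^ e = (q ^ e.sign) ^ k := by
    rw [← zpow_natCast, ← zpow_mul, hk, Int.sign_mul_natAbs]
  refine ⟨(qsize q : ℤ) ^ (E - k) * w ^ k, ?_, ?_⟩
  · rw [hqe]
    have hsplit : ((qsize q ^ E : ℕ) : ℚ) = ((qsize q : ℕ) : ℚ) ^ (E - k) * ((qsize q : ℕ) : ℚ) ^ k := by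
      push_cast; rw [← pow_add, Nat.sub_add_cancel hkE]
    rw [hsplit, mul_assoc, ← mul_pow, hw]
    push_cast
    ring
  · rw [abs_mul, abs_pow, abs_pow, Nat.abs_cast]
    calc (qsize q : ℤ) ^ (E - k) * |w| ^ k ≤ (qsize q : ℤ) ^ (E - k) * ((qsize q : ℤ) ^ 2) ^ k := by
          refine mul_le_mul_of_nonneg_left (pow_le_pow_left₀ (abs_nonneg _) hwabs k) (by positivity)
      _ = (qsize q : ℤ) ^ (E - k + 2 * k) := by rw [← pow_mul, ← pow_add]
      _ ≤ (qsize q : ℤ) ^ (2 * E) := pow_le_pow_right₀ hsz1 (by omega)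
      _ = ((qsize q : ℤ) ^ E) ^ 2 := by rw [← pow_mul, mul_comm]

/-- **The common denominator of the monomial box**: `monDen α E = ∏ⱼ (|aⱼ|·cⱼ)^{Eⱼ}`.
[cite: Nesterenko2003, §3.2; shape only] -/
def monDen (α : Fin m → ℚ) (E : Fin m → ℕ) : ℕ := ∏ j, qsize (α j) ^ E j

/-- `1 ≤ monDen`. [folklore] -/
theorem one_le_monDen (α : Fin m → ℚ) (hα : ∀ j, α j ≠ 0) (E : Fin m → ℕ) : 1 ≤ monDen α E := by
  unfold monDen
  exact Finset.one_le_prod' fun j _ => Nat.one_le_pow _ _ (one_le_qsize (hα j))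

/-- **Integrality and size of the cleared monomials**: for `|eⱼ| ≤ Eⱼ`,
`monDen α E · ∏ αⱼ^{eⱼ} = z ∈ ℤ` with `|z| ≤ (monDen α E)²`. [cite: Nesterenko2003, §3.2; shape only] -/
theorem exists_int_monDen_mul_prod_zpow (α : Fin m → ℚ) (hα : ∀ j, α j ≠ 0) (E : Fin m → ℕ)
    (e : Fin m → ℤ) (he : ∀ j, |e j| ≤ (E j : ℤ)) :
    ∃ z : ℤ, ((monDen α E : ℕ) : ℚ) * ∏ j, α j ^ e j = z ∧ |z| ≤ ((monDen α E : ℤ)) ^ 2 := by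
  classical
  choose z hz hzabs using fun j => int_mul_zpow_single (hα j) (he j)
  refine ⟨∏ j, z j, ?_, ?_⟩
  · unfold monDen
    push_cast
    rw [← Finset.prod_mul_distrib]
    refine Finset.prod_congr rfl fun j _ => ?_
    have := hz j; push_cast at this; exact this
  · unfold monDen
    rw [Finset.abs_prod]
    push_cast
    rw [← Finset.prod_pow]
    exact Finset.prod_le_prod (fun j _ => abs_nonneg _) fun j _ => hzabs j

/-- **Height cost of the common denominator**: `log monDen α E ≤ 2·∑ⱼ Eⱼ·h(αⱼ)`.
[cite: Nesterenko2003, §3.2; shape only] -/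
theorem log_monDen_le (α : Fin m → ℚ) (hα : ∀ j, α j ≠ 0) (E : Fin m → ℕ) :
    Real.log (monDen α E : ℝ) ≤ 2 * ∑ j, (E j : ℝ) * Height.logHeight₁ (α j) := by
  unfold monDen
  push_cast
  rw [Real.log_prod (s := Finset.univ) (fun j _ => ?_)]
  · rw [Finset.mul_sum]
    refine Finset.sum_le_sum fun j _ => ?_
    rw [Real.log_pow]
    have h := log_qsize_le (hα j)
    have hE : (0 : ℝ) ≤ E j := Nat.cast_nonneg _
    nlinarith
  · exact pow_ne_zero _ (by exact_mod_cast (show qsize (α j) ≠ 0 by have := one_le_qsize (hα j); omega))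

/-- The cleared monomial bound in logarithmic form: `log |monDen·∏αᵉ| ≤ 4·∑ Eⱼ h(αⱼ)` (when nonzero).
[cite: Nesterenko2003, §3.2; shape only] -/
theorem log_abs_monDen_mul_prod_zpow_le (α : Fin m → ℚ) (hα : ∀ j, α j ≠ 0) (E : Fin m → ℕ)
    (e : Fin m → ℤ) (he : ∀ j, |e j| ≤ (E j : ℤ)) :
    Real.log |((monDen α E : ℝ)) * ∏ j, ((α j : ℝ)) ^ e j| ≤
      4 * ∑ j, (E j : ℝ) * Height.logHeight₁ (α j) := by
  obtain ⟨z, hz, hzabs⟩ := exists_int_monDen_mul_prod_zpow α hα E e he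
  have hcast : ((monDen α E : ℝ)) * ∏ j, ((α j : ℝ)) ^ e j = (z : ℝ) := by
    have := congrArg (fun q : ℚ => (q : ℝ)) hz
    push_cast at this
    exact this
  rw [hcast]
  have h1 : (1 : ℝ) ≤ monDen α E := by exact_mod_cast one_le_monDen α hα E
  have hzR : |(z : ℝ)| ≤ ((monDen α E : ℝ)) ^ 2 := by exact_mod_cast hzabs
  rcases eq_or_ne z 0 with hz0 | hz0
  · rw [hz0]; simp only [Int.cast_zero, abs_zero, Real.log_zero]
    refine mul_nonneg (by norm_num) (Finset.sum_nonneg fun j _ => ?_)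
    exact mul_nonneg (Nat.cast_nonneg _) (Height.zero_le_logHeight₁ _)
  · have hpos : (0 : ℝ) < |(z : ℝ)| := abs_pos.mpr (by exact_mod_cast hz0)
    calc Real.log |(z : ℝ)| ≤ Real.log (((monDen α E : ℝ)) ^ 2) := Real.log_le_log hpos hzR
      _ = 2 * Real.log (monDen α E : ℝ) := by rw [Real.log_pow]; norm_num
      _ ≤ 2 * (2 * ∑ j, (E j : ℝ) * Height.logHeight₁ (α j)) :=
          mul_le_mul_of_nonneg_left (log_monDen_le α hα E) (by norm_num)
      _ = 4 * ∑ j, (E j : ℝ) * Height.logHeight₁ (α j) := by ring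

end Summit.ABC.StewartYu.MonomialDen

end
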